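import Summits.BirchSwinnertonDyer.Rank1Residual.X11a.SelmerCompanionNonsplitCoboundary
import Literature.NumberTheory.EllipticCurves.SelmerLocalConditionGoodReductionProofs
import HarnessLib

/-!
# Route (3e) SELMER COMPANION, XI-b: at a NON-SPLIT multiplicative place `v ∤ p` the unramified
# classes satisfy the local condition, and the sixth kind of place — a non-split multiplicative
# PARTNER at a place of good reduction (class X11a = N7; cell `b2b-bsdres`, unit `b2b-bsdres-x11a`,
# gen 28)

HONEST FRAMING (run/shared/lean/b2b/bsd-rank1-residual/, verbatim in every file): the goal of the
cell is to DELETE the COMBINATION-SHAPED residual classes of the Birch–Swinnerton-Dyer formula for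
ALL analytic-rank `≤ 1` elliptic curves over `ℚ` — "full BSD formula for every rank `≤ 1` curve in
class `C`" assembled STRICTLY from published theorems — so that the rank-`≤ 1` remainder becomes
exactly the CONSTRUCTION-SHAPED classes, which are TYPED (missing-input `Prop`s), NOT attempted.
This is not "finishing BSD". CLASS-OWNERS.md: research routes; NO CLAIM BEYOND STATED CLASSES.
THEOREMS ONLY; nothing booked; no label moves. CONDITIONAL on the PUBLISHED named fact
`Silverman1994_thmV53_corV54_tateUniformisation` (twisted Tate uniformisation, `hU`) where it is a
hypothesis.

## What is proved

* `unramifiedKer_primeBelow_le_selmerLocalKer_of_nonsplit` — **unramified ⟹ local Selmer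
  condition at a NON-SPLIT multiplicative place `v ∤ p`** (`p` odd, inertia fixing `√γ`): for the
  prime `𝔓 = 𝔓_{ι,𝔐}` of `\bar ℤ_K` cut out by the canonical embedding `ι : K̄ → K̄_v`,
  `unramifiedKer (E[p]) 𝔓 ≤ 𝓢_v(E)`. A cocycle `φ` of an unramified class is `τ ↦ τT₀ − T₀` on
  `I_𝔓`; the local crossed homomorphism `σ ↦ ι_* φ(res σ) − (σT − T)`, `T = ι_* T₀`, is killed by
  `p`, has a zero set containing `{φ ∘ res = 0} ∩ Stab(T)`, and vanishes on `I_𝔐` (local inertia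
  restricts into `I_𝔓`, `resGalOfEmb_mem_inertia_primeBelow`), so it is principal by file XI-a
  (`exists_eq_smul_sub_of_nonsplit`). With lemma L-ns (file IV) the local condition at such a place
  IS "unramified", exactly as at a good place (Gross 1991 (7.1)).
* `h1Equiv_mem_selmerLocalKer_of_good_of_nonsplit` (any `K`) and `…_rat` (over `ℚ`, odd `ℓ ≠ p`,
  the inertia hypothesis discharged by `X2.GreenbergVatsalTateDatumRat.inertia_fix_sqrt_gamma`) —
  **kind (vi): for `θ : E[p] ≃ A[p]` with `E` GOOD and `A` NON-SPLIT multiplicative at `v ∤ p`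
  (a level-RAISED partner at `v`; necessarily `p ∣ ord_v Δ_A`), `θ_* 𝓢_v(E) ≤ 𝓢_v(A)`**, i.e.
  `ι_v(θ) = 1` in the count of file I: Selmer for the good `E` ⟹ unramified (Gross (7.1), tree
  `selmerLocalKer_eq_unramifiedKer`) ⟹ unramified for `A` (`mem_unramifiedKer_iff_h1Equiv_mem`) ⟹
  Selmer for `A`. Census: `HOME/b2b-bsdres-x11a/g27/SELMER-COMPANION-CENSUS-v3.md` §6, the places
  `ℓ ≡ −1 (mod 3)` of N7 cells with `E` good and the partner non-split multiplicative. At a SPLIT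
  multiplicative partner place with `p ∣ ord_v Δ_A` the statement is false (the unramified class
  `F ↦ Ψ(Q^{1/p})` is not a Kummer class of `A`: `F(β)/β = Q^{1/p}` has no solution in `K_v^nr`):
  those places stay lossy (`ι_v = p`).

References: [SilvermanATAEC1994] Ch. V Lemma 5.2 (c), Thm. 5.3, Cor. 5.4, Ex. 5.11;
[MilneADT2006] I Prop. 3.8; [GrossLMS1991] (7.1); [MazurRubin2004] §2.3;
HOME/b2b-bsdres-x11a/REPORT-g28.md.
-/

set_option autoImplicit false

noncomputable section

open scoped Classical NNReal Topology

open WeierstrassCurve Literature.NumberTheory.EllipticCurves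
  Literature.NumberTheory.GaloisRepresentations Field NumberField IsDedekindDomain
  IsDedekindDomain.HeightOneSpectrum
  Literature.NumberTheory.EllipticCurves.Rank1Residual
  Literature.NumberTheory.EllipticCurves.Rank1Residual.Typed

namespace Summit.BirchSwinnertonDyer.Rank1Residual.X11a.SelmerCompanion

section Local

variable {K : Type} [Field K] [NumberField K] (W : WeierstrassCurve K) [W.IsElliptic]
  {p : ℕ} [hp : Fact p.Prime] (v : HeightOneSpectrum (𝓞 K))

/-- **Unramified ⟹ local Selmer condition, at a NON-SPLIT multiplicative place `v ∤ p`** (`p`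
odd, inertia fixing `√γ`): for the prime `𝔓 = 𝔓_{ι,𝔐}` of `\bar ℤ_K` cut out by the canonical
embedding `ι : K̄ → K̄_v` and the prime `𝔐` of `\bar 𝓞_v`,
`unramifiedKer (E[p]) 𝔓 ≤ 𝓢_v(E) = selmerLocalKer E K_v p`. A cocycle `φ` of an unramified class is
`τ ↦ τT₀ − T₀` on `I_𝔓` (`T₀ ∈ E[p]`); the local crossed homomorphism
`σ ↦ ι_* φ(res σ) − (σT − T)`, `T = ι_* T₀`, is killed by `p`, has open zero set, and vanishes on
`I_𝔐` (local inertia restricts into `I_𝔓`, `resGalOfEmb_mem_inertia_primeBelow`), so it is principal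
by `exists_eq_smul_sub_of_nonsplit`, i.e. the class dies in `H¹(K_v, E)`. The converse inclusion is
lemma L-ns (`selmerLocalKer_le_unramifiedKer_primeBelow_of_nonsplit`, file IV): at such a place the
local condition IS "unramified", exactly as at a good place (Gross (7.1)).
[cite: SilvermanATAEC1994, Ch. V Thm. 5.3, Cor. 5.4, Ex. 5.11] [cite: MilneADT2006, Ch. I Prop. 3.8]
[cite: GrossLMS1991, §7 (7.1)] -/
theorem unramifiedKer_primeBelow_le_selmerLocalKer_of_nonsplit
    (hU : Silverman1994_thmV53_corV54_tateUniformisation.{0}) (hp2 : p ≠ 2)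
    (hW : W.HasMultiplicativeReductionAt v)
    (hγ : ∀ r : v.adicCompletion K, algebraMap K (v.adicCompletion K) (-(W.c₄ / W.c₆)) ≠ r ^ 2)
    (hpv : (p : 𝓞 K) ∉ v.asIdeal)
    {𝔐 : Ideal v.localAbsIntegers} (h𝔐 : 𝔐 ∈ v.localPrimesAbove)
    (ht : ∀ t : AlgebraicClosure (v.adicCompletion K),
      t ^ 2 = algebraMap (v.adicCompletion K) (AlgebraicClosure (v.adicCompletion K))
        (algebraMap K (v.adicCompletion K) (-(W.c₄ / W.c₆))) →
      ∀ σ ∈ 𝔐.inertia (absoluteGaloisGroup (v.adicCompletion K)),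
        Field.absoluteGaloisGroup.toAlgEquiv (v.adicCompletion K) σ t = t) :
    unramifiedKer (geomTorsion W (p : ℤ))
        (v.primeBelow (closureEmb (K := K) (v.adicCompletion K)) 𝔐) ≤
      selmerLocalKer W (v.adicCompletion K) (p : ℤ) := by
  intro c hc
  obtain ⟨φ, rfl⟩ :=
    oneCocycleClass_surjective (discreteTopRep (absoluteGaloisGroup K) (geomTorsion W (p : ℤ))) c
  -- on `I_𝔓`, `φ` is the coboundary of some `T₀ ∈ E[p]`
  obtain ⟨T₀, hT₀⟩ := (oneCocycleClass_mem_subgroupResKer_iff _ φ).mp hc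
  set T : localPoints W (v.adicCompletion K) :=
    pointsMap W (v.adicCompletion K) (T₀ : geomPoints W) with hT
  -- the corrected local crossed homomorphism
  set g : absoluteGaloisGroup (v.adicCompletion K) → localPoints W (v.adicCompletion K) :=
    fun σ ↦ pointsMap W (v.adicCompletion K)
      ((φ.1 (resGal (K := K) (v.adicCompletion K) σ) : geomTorsion W (p : ℤ)) : geomPoints W) -
        (σ • T - T) with hgdef
  have hφmul : ∀ σ τ : absoluteGaloisGroup (v.adicCompletion K),
      pointsMap W (v.adicCompletion K) ((φ.1 (resGal (K := K) (v.adicCompletion K) (σ * τ)) :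
        geomTorsion W (p : ℤ)) : geomPoints W) =
      pointsMap W (v.adicCompletion K) ((φ.1 (resGal (K := K) (v.adicCompletion K) σ) :
        geomTorsion W (p : ℤ)) : geomPoints W) +
      σ • pointsMap W (v.adicCompletion K) ((φ.1 (resGal (K := K) (v.adicCompletion K) τ) :
        geomTorsion W (p : ℤ)) : geomPoints W) := by
    intro σ τ
    rw [map_mul, φ.2, discreteTopRep_ρ_apply, AddSubgroup.coe_add, map_add,
      Literature.NumberTheory.EllipticCurves.AddSubgroup.torsionBy.coe_smul, pointsMap_smul]
  have hg : ∀ σ τ, g (σ * τ) = g σ + σ • g τ := by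
    intro σ τ
    simp only [hgdef]
    rw [hφmul, mul_smul, smul_sub, smul_sub]
    abel
  have hg1 : {σ | g σ = 0} ∈ 𝓝 (1 : absoluteGaloisGroup (v.adicCompletion K)) := by
    have h1 : {σ : absoluteGaloisGroup (v.adicCompletion K) |
        φ.1 (resGal (K := K) (v.adicCompletion K) σ) = 0} ∈
          𝓝 (1 : absoluteGaloisGroup (v.adicCompletion K)) := by
      refine IsOpen.mem_nhds ?_ ?_
      · exact (isOpen_discrete ({0} : Set (geomTorsion W (p : ℤ)))).preimage
          (φ.1.continuous.comp (resGal (K := K) (v.adicCompletion K)).continuous)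
      · change φ.1 (resGal (K := K) (v.adicCompletion K) 1) = 0
        rw [map_one, contOneCocycles.apply_one]
    have h2 : ((MulAction.stabilizer (absoluteGaloisGroup (v.adicCompletion K)) T : Subgroup _) :
        Set (absoluteGaloisGroup (v.adicCompletion K))) ∈
          𝓝 (1 : absoluteGaloisGroup (v.adicCompletion K)) :=
      (W.isOpen_stabilizer_localPoints (v.adicCompletion K) T).mem_nhds (one_mem _)
    refine Filter.mem_of_superset (Filter.inter_mem h1 h2) fun σ hσ ↦ ?_
    simp only [Set.mem_inter_iff, Set.mem_setOf_eq, SetLike.mem_coe,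
      MulAction.mem_stabilizer_iff] at hσ
    simp only [hgdef, Set.mem_setOf_eq]
    rw [hσ.1, hσ.2, ZeroMemClass.coe_zero, map_zero, sub_self, sub_zero]
  have hgp : ∀ σ, (p : ℤ) • g σ = 0 := by
    intro σ
    simp only [hgdef]
    rw [zsmul_sub, ← map_zsmul, (mem_geomTorsion_iff W _ _).mp (φ.1 _).2, map_zero, zsmul_sub,
      ← W.smul_zsmul_localPoints (p : ℤ) σ T, hT, ← map_zsmul, (mem_geomTorsion_iff W _ _).mp T₀.2,
      map_zero, smul_zero, sub_self, sub_zero]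
  have hgI : ∀ σ ∈ 𝔐.inertia (absoluteGaloisGroup (v.adicCompletion K)), g σ = 0 := by
    intro σ hσ
    have hσ' := v.resGalOfEmb_mem_inertia_primeBelow (closureEmb (K := K) (v.adicCompletion K)) 𝔐 hσ
    have h : φ.1 (resGal (K := K) (v.adicCompletion K) σ) =
        resGal (K := K) (v.adicCompletion K) σ • T₀ - T₀ := by
      rw [resGal_eq]
      exact hT₀ ⟨_, hσ'⟩
    simp only [hgdef]
    rw [h, AddSubgroup.coe_sub, map_sub,
      Literature.NumberTheory.EllipticCurves.AddSubgroup.torsionBy.coe_smul, pointsMap_smul, ← hT,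
      sub_self]
  obtain ⟨b, hb⟩ := exists_eq_smul_sub_of_nonsplit W v hU hp2 hW hγ hpv h𝔐 ht hg hg1 hgp hgI
  rw [selmerLocalKer, oneCocycleClass_mem_resKer_iff]
  refine ⟨b + T, fun σ ↦ ?_⟩
  have h := hb σ
  simp only [hgdef, sub_eq_iff_eq_add] at h
  change pointsMap W (v.adicCompletion K)
    ((φ.1 (resGal (K := K) (v.adicCompletion K) σ) : geomTorsion W (p : ℤ)) : geomPoints W) = _
  rw [h, smul_add]
  abel

/-- **Kind (vi): the local conditions agree along `θ : E[p] ≃ A[p]` at a place `v ∤ p` where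
`E` has GOOD reduction and `A` is NON-SPLIT multiplicative (inertia fixing `√γ(A)`)** — a
level-RAISED partner at `v`. `θ_* 𝓢_v(E) ≤ 𝓢_v(A)`: a class Selmer for the good curve `E` at `v` is
unramified at `𝔓 = 𝔓_{ι,𝔐}` (Gross (7.1), tree `selmerLocalKer_eq_unramifiedKer`), unramifiedness
passes through `θ` (`mem_unramifiedKer_iff_h1Equiv_mem`), and unramified classes of `H¹(K, A[p])`
are Selmer for `A` at `v` (`unramifiedKer_primeBelow_le_selmerLocalKer_of_nonsplit`). So
`ι_v(θ) = 1` in the count of file I. [cite: SilvermanATAEC1994, Ch. V Thm. 5.3, Cor. 5.4, Ex. 5.11]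
[cite: GrossLMS1991, §7 (7.1)] [cite: MilneADT2006, Ch. I Prop. 3.8] -/
theorem h1Equiv_mem_selmerLocalKer_of_good_of_nonsplit
    (hU : Silverman1994_thmV53_corV54_tateUniformisation.{0}) (hp2 : p ≠ 2)
    (A : WeierstrassCurve K) [A.IsElliptic]
    (θ : geomTorsion W (p : ℤ) ≃+ geomTorsion A (p : ℤ))
    (hθ : ∀ (σ : absoluteGaloisGroup K) (P : geomTorsion W (p : ℤ)), θ (σ • P) = σ • θ P)
    (hW : W.HasGoodReductionAt v) (hA : A.HasMultiplicativeReductionAt v)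
    (hγ : ∀ r : v.adicCompletion K, algebraMap K (v.adicCompletion K) (-(A.c₄ / A.c₆)) ≠ r ^ 2)
    (hpv : (p : 𝓞 K) ∉ v.asIdeal)
    (ht : ∀ {𝔐 : Ideal v.localAbsIntegers}, 𝔐 ∈ v.localPrimesAbove →
      ∀ t : AlgebraicClosure (v.adicCompletion K),
      t ^ 2 = algebraMap (v.adicCompletion K) (AlgebraicClosure (v.adicCompletion K))
        (algebraMap K (v.adicCompletion K) (-(A.c₄ / A.c₆))) →
      ∀ σ ∈ 𝔐.inertia (absoluteGaloisGroup (v.adicCompletion K)),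
        Field.absoluteGaloisGroup.toAlgEquiv (v.adicCompletion K) σ t = t)
    {c : galH1Torsion W (p : ℤ)} (hc : c ∈ selmerLocalKer W (v.adicCompletion K) (p : ℤ)) :
    h1Equiv θ hθ c ∈ selmerLocalKer A (v.adicCompletion K) (p : ℤ) := by
  obtain ⟨𝔐, h𝔐⟩ := v.localPrimesAbove_nonempty
  have h𝔓 := HeightOneSpectrum.primeBelow_mem_primesAbove
    (ι := closureEmb (K := K) (v.adicCompletion K)) h𝔐
  have hpv' : (((p : ℤ)) : 𝓞 K) ∉ v.asIdeal := by rwa [Int.cast_natCast]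
  have hur : c ∈ unramifiedKer (geomTorsion W (p : ℤ))
      (v.primeBelow (closureEmb (K := K) (v.adicCompletion K)) 𝔐) := by
    rw [← W.selmerLocalKer_eq_unramifiedKer hW hpv' h𝔓]
    exact hc
  exact unramifiedKer_primeBelow_le_selmerLocalKer_of_nonsplit A v hU hp2 hA hγ hpv h𝔐 (ht h𝔐)
    ((mem_unramifiedKer_iff_h1Equiv_mem A W θ hθ _ c).mp hur)

end Local

/-! ### Over `ℚ`: the inertia hypothesis is automatic at odd primes; kind (vi) -/

section Rat

variable (W A : WeierstrassCurve ℚ) [W.IsElliptic] [A.IsElliptic] [A.IsGloballyMinimal]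
  (p : ℕ) [hp : Fact p.Prime]

/-- **Kind (vi) over `ℚ`**: for `θ : E[p] ≃ A[p]`, an odd prime `ℓ ≠ p` at which `E` has good
reduction and the globally minimal partner `A` NON-SPLIT multiplicative reduction (`γ(A)` not a
square in `ℚ_ℓ`), `θ_* 𝓢_ℓ(E) ≤ 𝓢_ℓ(A)`. The inertia hypothesis of the general lemma is the tree's
`X2.GreenbergVatsalTateDatumRat.inertia_fix_sqrt_gamma` for `A` (`c₄, c₆` are `ℓ`-units, `ℓ` odd).
[cite: SilvermanATAEC1994, Ch. V Thm. 5.3, Cor. 5.4, Ex. 5.11] [cite: GrossLMS1991, §7 (7.1)]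
[cite: MilneADT2006, Ch. I Prop. 3.8] -/
theorem h1Equiv_mem_selmerLocalKer_of_good_of_nonsplit_rat
    (hU : Silverman1994_thmV53_corV54_tateUniformisation.{0}) (hp2 : p ≠ 2)
    (θ : geomTorsion W (p : ℤ) ≃+ geomTorsion A (p : ℤ))
    (hθ : ∀ (σ : absoluteGaloisGroup ℚ) (P : geomTorsion W (p : ℤ)), θ (σ • P) = σ • θ P)
    {v : HeightOneSpectrum (𝓞 ℚ)} {ℓ : ℕ} [Fact ℓ.Prime] (hℓ2 : ℓ ≠ 2)
    (hℓv : (ℓ : 𝓞 ℚ) ∈ v.asIdeal) (hW : W.HasGoodReductionAt v)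
    (hmult : A.HasMultiplicativeReductionAtPrime ℓ)
    (hγ : ∀ r : v.adicCompletion ℚ, algebraMap ℚ (v.adicCompletion ℚ) (-(A.c₄ / A.c₆)) ≠ r ^ 2)
    (hpv : (p : 𝓞 ℚ) ∉ v.asIdeal)
    {c : galH1Torsion W (p : ℤ)} (hc : c ∈ selmerLocalKer W (v.adicCompletion ℚ) (p : ℤ)) :
    h1Equiv θ hθ c ∈ selmerLocalKer A (v.adicCompletion ℚ) (p : ℤ) := by
  have hA : A.HasMultiplicativeReductionAt v := by
    have hvp : (Rat.HeightOneSpectrum.primesEquiv v : ℕ) = ℓ :=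
      Rat.HeightOneSpectrum.primesEquiv_eq_of_natCast_mem v (Fact.out : ℓ.Prime) hℓv
    have h := A.hasMultiplicativeReductionAtPrime_iff_hasMultiplicativeReductionAt_ringOfIntegers v
    subst hvp
    exact h.mp hmult
  obtain ⟨w, hw⟩ := v.exists_spectralValuation
  refine h1Equiv_mem_selmerLocalKer_of_good_of_nonsplit W v hU hp2 A θ hθ hW hA hγ hpv
    (fun {𝔐} h𝔐 t ht2 σ hσ ↦ ?_) hc
  rw [HeightOneSpectrum.inertia_eq_absInertia hw h𝔐] at hσ
  exact X2.GreenbergVatsalTateDatumRat.inertia_fix_sqrt_gamma A hℓ2 hmult hℓv t ht2 σ hσ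

end Rat

end Summit.BirchSwinnertonDyer.Rank1Residual.X11a.SelmerCompanion

end
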